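import Summits.BirchSwinnertonDyer.BirchSwinnertonDyer.Theorems.ByReductionTypeAtTwoMultTowerNS2LayerZeroRelNormPrelim
import HarnessLib

/-!
# Route `ByReductionTypeAtTwo`, crux `MultUpperHalfAtTwo` (item stmt-BirchSwinnertonDyer-19922), TOWER road, NON-SPLIT rows:
# the layer-`0` order of the local tower kernel at a non-split `2`, part 7 — RELATIVE NORM EXISTENCE for the cyclic
# layers `F'_n = K̄_v^{H_n ∩ Stab t}` over the unramified quadratic field `M = ℚ_v(t) = K̄_v^{Stab t}`

HONEST FRAMING (cell `bsd-2adic`, run/shared/lean/pub/bsd-2adic/, seat `bsd-2adic-tower-1` GEN 30, HUMAN RULINGS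
D-0036 / D-0054 / D-0074): TOOL theorem only (no definition, no named fact, no `sorry`); closes nothing by itself;
nothing booked; BSD is not proved by any of this. Seventh brick of the layer-`0` count `#𝒦_{v,0}[2^∞] = 2·c₂^{(2)}` at a
non-split multiplicative `2` (R. Greenberg, LNM 1716, §3 p. 93 / §4 p. 113); scope memo
`tower/SCOPE-NS2-LAYER0-EXACT-GEN29.md` (L1)/(L2): the LOWER bounds need elements of the layers `F'_n` with PRESCRIBED
relative norm to `M` (the unramified quadratic field of the twisted Tate module).

* `exists_prod_smul_eq_of_norm_mem_range_norm_layer` — **relative norm existence.** Setting: `v ∋ 2`, `κ` cyclotomic,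
  `t ∈ K̄_v` non-zero with `σt = ±t` for all `σ`, a flip `τ₀ ∈ H_∞` (`τ₀t = −t`), a generator `g` at the layer `0`
  (`κ(res g)` a unit) FIXING `t`, a level `n ≥ 1`, and the layer-`0` class-field input
  «`ℚ_vˣ = 2^ℤ · N(ℚ_v(t)ˣ)`» (every unit of `ℚ_v` is a norm `f₀·τ₀f₀` from `ℚ_v(t)`; supplied by the consumer from
  `MultTowerNS2LayerZero.exists_norm_eq_of_unit`). THEN every `c ∈ ℚ_v(t)ˣ` whose norm `c·τ₀c` is a norm from the
  cyclotomic layer `F_n = K̄_v^{H_n}` is a relative norm from `F'_n`: `c = ∏_{i<2^n} gⁱ f` with `f ≠ 0` fixed by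
  `H_n ∩ Stab t`. In particular every `c` with `c·τ₀c = 1`.
  Proof (transfer by counting, part 6 for the inputs): `[Mˣ : N(F'_nˣ)] = 2^n` and `N_{F'_n/M}(f) = ∏_{i<2^n} gⁱf`;
  the homomorphism `φ : Mˣ → ℚ_vˣ/N(F_nˣ)`, `c ↦ [c·τ₀c]`, kills `N(F'_nˣ)` (`N_{M/ℚ_v}(∏gⁱf) = ∏ gⁱ(f·τ₀f) =
  N_{F_n/ℚ_v}(f·τ₀f)`) and is ONTO (units are norms from `M`, `2 ∈ N(F_nˣ)`), so `[Mˣ : ker φ] = [ℚ_vˣ : N(F_nˣ)] = 2^n`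
  (BRICK 14 `index_range_norm_fixedField_layer`) and `N(F'_nˣ) = ker φ`.

References: R. Greenberg, LNM 1716 (1999), §3 p. 93; J. Neukirch, *ANT* IV (3.5), V §1 Thm. (1.1) and Cor. (1.2)
(norm groups under field extension: `N_{LM/M} = N_{M/K}⁻¹(N_{L/K})` for `L/K` cyclic, `M/K` unramified);
L. Washington, *Cyclotomic Fields*, §13.1, Prop. 2.16.
-/

set_option autoImplicit false
-- the Theorems namespace of this sub repeats the summit name by design (D-0017 nested layout: Summit.<S>.<Sub>)
set_option linter.dupNamespace false

noncomputable section

open scoped Classical IntermediateField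

namespace Summit.BirchSwinnertonDyer.BirchSwinnertonDyer.Theorems.MultTowerNS2LayerZero

open NumberField IsDedekindDomain Field PadicInt Literature.NumberTheory.EllipticCurves
  Literature.NumberTheory.GaloisRepresentations Summit.BirchSwinnertonDyer.BirchSwinnertonDyer.Theorems.MultTowerNS2

variable {κ : ZpExtension ℚ 2}

/-! ### Relative norm existence -/

/-- **Relative norm existence for the cyclic layers over `ℚ_v(t)`.** Let `v ∋ 2`, `κ` cyclotomic, `t ≠ 0` with `σt = ±t`
for every `σ ∈ Γ_{ℚ_v}`, `τ₀ ∈ H_∞` a flip (`τ₀t = −t`), `g` a generator at the layer `0` (`κ(res g)` a unit) with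
`gt = t`, `n ≥ 1`, and assume the layer-`0` class field input: every `x ∈ ℚ_vˣ` is `2^k · f₀·τ₀f₀` with `f₀ ≠ 0` fixed by
`Stab(t)`. If `c ≠ 0` is fixed by `Stab(t)` and `c·τ₀c ∈ N_{F_n/ℚ_v}(F_nˣ)` (`F_n = K̄_v^{H_n}`), then
`c = ∏_{i<2^n} gⁱf` for some `f ≠ 0` fixed by `H_n ∩ Stab(t)` — i.e. `c ∈ N(F'_n/ℚ_v(t))`, `F'_n = K̄_v^{H_n ∩ Stab t}`.
Transfer by counting: `[ℚ_v(t)ˣ : N F'_nˣ] = 2^n` (class field axiom for the cyclic layer, PROVED in the tree) equals the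
index of the kernel of `c ↦ [c·τ₀c] ∈ ℚ_vˣ/N(F_nˣ)`, which contains `N F'_nˣ`.
[cite: NeukirchANT1999, Ch. V §1 Thm. (1.1) and Cor. (1.2)] [cite: Washington1997, §13.1, Prop. 2.16] -/
theorem exists_prod_smul_eq_of_norm_mem_range_norm_layer (hκ : κ.IsCyclotomic) (v : HeightOneSpectrum (𝓞 ℚ))
    (hv : ((2 : ℕ) : 𝓞 ℚ) ∈ v.asIdeal) {n : ℕ} (hn : 1 ≤ n) {t : AlgebraicClosure (v.adicCompletion ℚ)}
    (ht : ∀ σ : absoluteGaloisGroup (v.adicCompletion ℚ), σ • t = t ∨ σ • t = -t) (ht0 : t ≠ 0)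
    {τ₀ : absoluteGaloisGroup (v.adicCompletion ℚ)} (hτ₀ : τ₀ ∈ localSubgroup κ.kerSubgroup (v.adicCompletion ℚ))
    (hτ₀t : τ₀ • t = -t) {g : absoluteGaloisGroup (v.adicCompletion ℚ)} {u : ℤ_[2]ˣ}
    (hu : ((κ (resGal (K := ℚ) (v.adicCompletion ℚ) g)).toAdd : ℤ_[2]) = 2 ^ 0 * (u : ℤ_[2])) (hgt : g • t = t)
    (hunit : ∀ x : (v.adicCompletion ℚ)ˣ, ∃ (k : ℤ) (f₀ : AlgebraicClosure (v.adicCompletion ℚ)), f₀ ≠ 0 ∧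
      (∀ σ : absoluteGaloisGroup (v.adicCompletion ℚ), σ • t = t → σ • f₀ = f₀) ∧
      algebraMap (v.adicCompletion ℚ) (AlgebraicClosure (v.adicCompletion ℚ)) (x : v.adicCompletion ℚ) =
        (2 : AlgebraicClosure (v.adicCompletion ℚ)) ^ k * (f₀ * τ₀ • f₀))
    {c : AlgebraicClosure (v.adicCompletion ℚ)} (hc0 : c ≠ 0)
    (hcS : ∀ σ : absoluteGaloisGroup (v.adicCompletion ℚ), σ • t = t → σ • c = c)
    (hcN : ∃ x : (v.adicCompletion ℚ)ˣ,
      x ∈ (Units.map (Algebra.norm (v.adicCompletion ℚ) :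
        IntermediateField.fixedField (localSubgroup (κ.layerSubgroup n) (v.adicCompletion ℚ)) →*
          v.adicCompletion ℚ)).range ∧
      algebraMap (v.adicCompletion ℚ) (AlgebraicClosure (v.adicCompletion ℚ)) (x : v.adicCompletion ℚ) = c * τ₀ • c) :
    ∃ f : AlgebraicClosure (v.adicCompletion ℚ), f ≠ 0 ∧
      (∀ h ∈ localSubgroup (κ.layerSubgroup n) (v.adicCompletion ℚ), h • t = t → h • f = f) ∧
      (∏ i ∈ Finset.range (2 ^ n), (g ^ i) • f) = c := by
  /- ───── A. the groups (all `localSubgroup` terms are built BEFORE `CharZero ℚ_v` enters the context) ───── -/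
  set Hn : Subgroup (absoluteGaloisGroup (v.adicCompletion ℚ)) := localSubgroup (κ.layerSubgroup n) (v.adicCompletion ℚ) with hHn
  have hopenHn : IsOpen (Hn : Set (absoluteGaloisGroup (v.adicCompletion ℚ))) :=
    isOpen_localSubgroup (κ.layerSubgroup n) (κ.isOpen_layerSubgroup n) (v.adicCompletion ℚ)
  haveI hnormHn : Hn.Normal := by
    rw [hHn, localSubgroup_eq_comap]; exact Subgroup.Normal.comap inferInstance _
  have hτ₀n : τ₀ ∈ Hn := by
    rw [hHn, mem_localSubgroup_iff]
    rw [mem_localSubgroup_iff] at hτ₀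
    exact κ.kerSubgroup_le_layerSubgroup n hτ₀
  set St : Subgroup (absoluteGaloisGroup (v.adicCompletion ℚ)) := MulAction.stabilizer (absoluteGaloisGroup (v.adicCompletion ℚ)) t with hSt
  have hopenSt : IsOpen (St : Set (absoluteGaloisGroup (v.adicCompletion ℚ))) := isOpen_stabilizer v t
  set D : Subgroup (absoluteGaloisGroup (v.adicCompletion ℚ)) := Hn ⊓ St with hD
  have hopenD : IsOpen (D : Set (absoluteGaloisGroup (v.adicCompletion ℚ))) := hopenHn.inter hopenSt
  have memD : ∀ {h : absoluteGaloisGroup (v.adicCompletion ℚ)}, h ∈ D ↔ h ∈ Hn ∧ h • t = t := fun {h} ↦ by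
    rw [hD, Subgroup.mem_inf, hSt, MulAction.mem_stabilizer_iff]
  have hgpt : ∀ i : ℕ, (g ^ i) • t = t := fun i ↦ by
    induction i with
    | zero => rw [pow_zero, one_smul]
    | succ i ih => rw [pow_succ, mul_smul, hgt, ih]
  have hN0 : ∀ f : AlgebraicClosure (v.adicCompletion ℚ), f ≠ 0 → f * τ₀ • f ≠ 0 := fun f hf ↦
    mul_ne_zero hf ((smul_ne_zero_iff_ne τ₀).mpr hf)
  -- `f·τ₀f ∈ F_n` for `f ∈ F'_n`
  have hFn : ∀ f : AlgebraicClosure (v.adicCompletion ℚ), (∀ h ∈ Hn, h • t = t → h • f = f) →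
      ∀ h ∈ Hn, h • (f * τ₀ • f) = f * τ₀ • f := by
    intro f hf h hh
    have step : ∀ h ∈ Hn, h • t = t → h • (f * τ₀ • f) = f * τ₀ • f := fun h hh hht ↦ by
      rw [smul_mul', hf h hh hht, ← flip_smul_smul_comm ht hτ₀n hτ₀t hht hf, hf h hh hht]
    rcases ht h with hht | hht
    · exact step h hh hht
    · have h1 : h * τ₀⁻¹ ∈ Hn := Hn.mul_mem hh (Hn.inv_mem hτ₀n)
      have h1t : (h * τ₀⁻¹) • t = t := by
        rw [mul_smul, inv_smul_eq_smul_of_smul_eq_or (ht τ₀), hτ₀t, smul_neg, hht, neg_neg]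
      have e : h = (h * τ₀⁻¹) * τ₀ := by group
      rw [e, mul_smul, smul_mul', flip_smul_flip_smul hτ₀n hτ₀t hf, mul_comm (τ₀ • f) f]
      exact step _ h1 h1t
  have memSt : ∀ {h : absoluteGaloisGroup (v.adicCompletion ℚ)}, h ∈ St ↔ h • t = t := fun {h} ↦ by
    rw [hSt, MulAction.mem_stabilizer_iff]
  -- `2 ∈ N(F_nˣ)` (before `CharZero`)
  obtain ⟨u2, hu2N, hu2⟩ := exists_mem_range_norm_layer_val_eq_two hκ v hv hn
  /- ───── B. the fields `M = K̄^{Stab t} ≤ F'_n = K̄^{H_n ∩ Stab t}` and `F_n = K̄^{H_n}` ───── -/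
  haveI : CharZero (v.adicCompletion ℚ) := charZero_of_injective_algebraMap (algebraMap ℚ (v.adicCompletion ℚ)).injective
  set M₀ : IntermediateField (v.adicCompletion ℚ) (AlgebraicClosure (v.adicCompletion ℚ)) := IntermediateField.fixedField St with hM₀
  set L₀ : IntermediateField (v.adicCompletion ℚ) (AlgebraicClosure (v.adicCompletion ℚ)) := IntermediateField.fixedField D with hL₀
  set F₀ : IntermediateField (v.adicCompletion ℚ) (AlgebraicClosure (v.adicCompletion ℚ)) := IntermediateField.fixedField Hn with hF₀
  have memM : ∀ {x : AlgebraicClosure (v.adicCompletion ℚ)}, x ∈ M₀ ↔ ∀ σ : absoluteGaloisGroup (v.adicCompletion ℚ), σ • t = t → σ • x = x :=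
    fun {x} ↦ by
      rw [hM₀, IntermediateField.mem_fixedField_iff]
      exact ⟨fun H σ hσ ↦ H σ (memSt.mpr hσ), fun H σ hσ ↦ H σ (memSt.mp hσ)⟩
  have memL : ∀ {x : AlgebraicClosure (v.adicCompletion ℚ)}, x ∈ L₀ ↔ ∀ h ∈ Hn, h • t = t → h • x = x := fun {x} ↦ by
    rw [hL₀, IntermediateField.mem_fixedField_iff]
    exact ⟨fun H h hh hht ↦ H h (memD.mpr ⟨hh, hht⟩), fun H h hh ↦ H h (memD.mp hh).1 (memD.mp hh).2⟩
  have memF : ∀ {x : AlgebraicClosure (v.adicCompletion ℚ)}, x ∈ F₀ ↔ ∀ h ∈ Hn, h • x = x := fun {x} ↦ by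
    rw [hF₀, IntermediateField.mem_fixedField_iff]; rfl
  have hML : M₀ ≤ L₀ := fun x hx ↦ memL.mpr fun h _ hht ↦ memM.mp hx h hht
  letI : Algebra M₀ L₀ := LocalWeilDatum.towerAlgebra hML
  -- the imported norm data, re-stated in the local syntax (`M₀`, `L₀`, `F₀`)
  obtain ⟨hidxNL', hnormM''⟩ :=
    index_range_norm_relLayer_eq_and_norm_eq_prod_smul hκ v hv n ht ht0 hτ₀ hτ₀t hu hgt hML
  set NF : Subgroup (v.adicCompletion ℚ)ˣ :=
    (Units.map (Algebra.norm (v.adicCompletion ℚ) : F₀ →* (v.adicCompletion ℚ))).range with hNF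
  set NL : Subgroup M₀ˣ := (Units.map (Algebra.norm M₀ : L₀ →* M₀)).range with hNL
  have hidxNL : NL.index = 2 ^ n := hidxNL'
  have hnormM : ∀ f : L₀, ((Algebra.norm M₀ f : M₀) : AlgebraicClosure (v.adicCompletion ℚ)) =
      ∏ i ∈ Finset.range (2 ^ n), (g ^ i) • (f : AlgebraicClosure (v.adicCompletion ℚ)) := fun f ↦ hnormM'' f
  have hnormF : ∀ ℓ : F₀, algebraMap (v.adicCompletion ℚ) (AlgebraicClosure (v.adicCompletion ℚ))
      (Algebra.norm (v.adicCompletion ℚ) ℓ) =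
        ∏ i ∈ Finset.range (2 ^ n), (g ^ i) • (ℓ : AlgebraicClosure (v.adicCompletion ℚ)) := fun ℓ ↦
    algebraMap_norm_layer_eq_prod_pow_smul hκ v hv n hu ℓ
  have hnormK : ∀ k : M₀, algebraMap (v.adicCompletion ℚ) (AlgebraicClosure (v.adicCompletion ℚ))
      (Algebra.norm (v.adicCompletion ℚ) k) =
        (k : AlgebraicClosure (v.adicCompletion ℚ)) * τ₀ • (k : AlgebraicClosure (v.adicCompletion ℚ)) := fun k ↦
    algebraMap_norm_stabilizer_eq_mul_smul v ht ht0 hτ₀t k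
  have hidxNF : NF.index = 2 ^ n := index_range_norm_fixedField_layer hκ v hv n
  have hu2NF : u2 ∈ NF := hu2N
  /- ───── G. the homomorphism `φ : Mˣ → ℚ_vˣ / N(F_nˣ)` ───── -/
  let φ : M₀ˣ →* (v.adicCompletion ℚ)ˣ ⧸ NF :=
    (QuotientGroup.mk' NF).comp (Units.map (Algebra.norm (v.adicCompletion ℚ) : M₀ →* (v.adicCompletion ℚ)))
  have hφ : ∀ uu : M₀ˣ, φ uu = 1 ↔ Units.map (Algebra.norm (v.adicCompletion ℚ) : M₀ →* (v.adicCompletion ℚ)) uu ∈ NF :=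
    fun uu ↦ by
      change ((QuotientGroup.mk' NF) (Units.map (Algebra.norm (v.adicCompletion ℚ) : M₀ →* (v.adicCompletion ℚ)) uu)) = 1 ↔ _
      rw [QuotientGroup.mk'_apply, QuotientGroup.eq_one_iff]
  -- (G1) `N(F'_nˣ) ≤ ker φ`
  have hker : NL ≤ φ.ker := by
    rintro _ ⟨fu, rfl⟩
    rw [MonoidHom.mem_ker, hφ]
    have hf0 : ((fu : L₀) : AlgebraicClosure (v.adicCompletion ℚ)) ≠ 0 := fun h0 ↦ fu.ne_zero (Subtype.ext h0)
    have hfL : ∀ h ∈ Hn, h • t = t → h • ((fu : L₀) : AlgebraicClosure (v.adicCompletion ℚ)) = (fu : L₀) :=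
      memL.mp (fu : L₀).2
    have hℓ0 := hN0 _ hf0
    have hℓmem : ((fu : L₀) : AlgebraicClosure (v.adicCompletion ℚ)) * τ₀ • ((fu : L₀) : AlgebraicClosure (v.adicCompletion ℚ))
        ∈ F₀ := memF.mpr (hFn _ hfL)
    refine ⟨Units.mk0 (⟨_, hℓmem⟩ : F₀) (fun h0 ↦ hℓ0 (congrArg Subtype.val h0)), Units.ext ?_⟩
    apply (algebraMap (v.adicCompletion ℚ) (AlgebraicClosure (v.adicCompletion ℚ))).injective
    refine ((hnormF ⟨_, hℓmem⟩).trans ?_).trans (hnormK (Algebra.norm M₀ (fu : L₀))).symm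
    rw [hnormM, Finset.smul_prod', ← Finset.prod_mul_distrib]
    refine Finset.prod_congr rfl fun i _ ↦ ?_
    change (g ^ i) • (((fu : L₀) : AlgebraicClosure (v.adicCompletion ℚ)) *
        τ₀ • ((fu : L₀) : AlgebraicClosure (v.adicCompletion ℚ))) =
      (g ^ i) • ((fu : L₀) : AlgebraicClosure (v.adicCompletion ℚ)) *
        τ₀ • (g ^ i) • ((fu : L₀) : AlgebraicClosure (v.adicCompletion ℚ))
    rw [smul_mul', flip_smul_smul_comm ht hτ₀n hτ₀t (hgpt i) hfL]
  -- (G2) `φ` is onto: `ℚ_vˣ = 2^ℤ · N(Mˣ)` and `2 ∈ N(F_nˣ)`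
  have hsurj : Function.Surjective φ := by
    intro qq
    obtain ⟨x, rfl⟩ := QuotientGroup.mk_surjective qq
    obtain ⟨k, f₀, hf₀0, hf₀S, hx⟩ := hunit x
    have hk₀0 : (⟨f₀, memM.mpr hf₀S⟩ : M₀) ≠ 0 := fun h0 ↦ hf₀0 (congrArg Subtype.val h0)
    refine ⟨Units.mk0 _ hk₀0, ?_⟩
    change ((QuotientGroup.mk' NF) (Units.map (Algebra.norm (v.adicCompletion ℚ) : M₀ →* (v.adicCompletion ℚ))
      (Units.mk0 _ hk₀0))) = QuotientGroup.mk x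
    rw [QuotientGroup.mk'_apply, QuotientGroup.eq]
    have e : (Units.map (Algebra.norm (v.adicCompletion ℚ) : M₀ →* (v.adicCompletion ℚ)) (Units.mk0 _ hk₀0))⁻¹ * x =
        u2 ^ k := by
      apply Units.ext
      push_cast
      apply (algebraMap (v.adicCompletion ℚ) (AlgebraicClosure (v.adicCompletion ℚ))).injective
      rw [map_mul, map_inv₀, map_zpow₀, hu2, map_ofNat, hx]
      have e1 : algebraMap (v.adicCompletion ℚ) (AlgebraicClosure (v.adicCompletion ℚ))
          ((Units.map (Algebra.norm (v.adicCompletion ℚ) : M₀ →* (v.adicCompletion ℚ)) (Units.mk0 _ hk₀0) :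
            (v.adicCompletion ℚ)ˣ) : v.adicCompletion ℚ) = f₀ * τ₀ • f₀ := hnormK ⟨f₀, memM.mpr hf₀S⟩
      rw [e1]
      have hτf : τ₀ • f₀ ≠ 0 := (smul_ne_zero_iff_ne τ₀).mpr hf₀0
      field_simp
    rw [e]
    exact NF.zpow_mem hu2NF k
  -- (G3) counting: `ker φ = N(F'_nˣ)`
  have hidxker : φ.ker.index = 2 ^ n := by
    rw [Subgroup.index_ker, MonoidHom.range_eq_top_of_surjective _ hsurj, Subgroup.card_top]
    exact hidxNF
  have hNLker : NL = φ.ker :=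
    subgroup_eq_of_le_of_index_eq hker (hidxNL.trans hidxker.symm) (by rw [hidxker]; positivity)
  /- ───── H. conclusion: `c ∈ ker φ = N(F'_nˣ)` ───── -/
  have hkc0 : (⟨c, memM.mpr hcS⟩ : M₀) ≠ 0 := fun h0 ↦ hc0 (congrArg Subtype.val h0)
  have hmem : Units.mk0 _ hkc0 ∈ φ.ker := by
    rw [MonoidHom.mem_ker, hφ]
    obtain ⟨x, hxN, hxc⟩ := hcN
    have e : Units.map (Algebra.norm (v.adicCompletion ℚ) : M₀ →* (v.adicCompletion ℚ)) (Units.mk0 _ hkc0) = x := by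
      apply Units.ext
      apply (algebraMap (v.adicCompletion ℚ) (AlgebraicClosure (v.adicCompletion ℚ))).injective
      exact (hnormK ⟨c, memM.mpr hcS⟩).trans hxc.symm
    rw [e]
    exact hxN
  rw [← hNLker] at hmem
  obtain ⟨fu, hfu⟩ := hmem
  refine ⟨((fu : L₀) : AlgebraicClosure (v.adicCompletion ℚ)), fun h0 ↦ fu.ne_zero (Subtype.ext h0), memL.mp (fu : L₀).2, ?_⟩
  have h1 : (Algebra.norm M₀ (fu : L₀) : M₀) = ⟨c, memM.mpr hcS⟩ := by
    have := congrArg (fun uu : M₀ˣ ↦ (uu : M₀)) hfu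
    simpa only [Units.coe_map, MonoidHom.coe_coe, Units.val_mk0] using this
  have h2 := congrArg (fun y : M₀ ↦ (y : AlgebraicClosure (v.adicCompletion ℚ))) h1
  exact (hnormM (fu : L₀)).symm.trans h2

end Summit.BirchSwinnertonDyer.BirchSwinnertonDyer.Theorems.MultTowerNS2LayerZero

end
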